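import Literature.NumberTheory.Sieve.GoldbachLinnikRomanovCertDefs
import Literature.NumberTheory.Sieve.GoldbachLinnikRomanovCertData1
import Literature.NumberTheory.Sieve.GoldbachLinnikRomanovCertData2

/-!
# Romanov certificate — head sums 7/7

Kernel evaluation (`decide +kernel`) of the checker of `GoldbachLinnikRomanovCertDefs.lean` on the records
`parseRecs 20000 (digitsOf (fsegs1 ++ fsegs2))` of `GoldbachLinnikRomanovCertData1/2.lean`; soundness: `GoldbachLinnikRomanovCertSound1.lean`,
`GoldbachLinnikRomanovCertTop.lean`. [folklore]
-/

namespace Literature.NumberTheory.Sieve.RomanovCert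

set_option maxHeartbeats 0 in
/-- The head accumulators `(T⁺, T⁻, I, S⁺, S⁻, ok)` on `d ∈ [24576, 28672)`. [folklore] -/
theorem head_24576 : headSums (parseRecs 20000 (digitsOf (fsegs1 ++ fsegs2))) 24576 4096 = (344212664769951846, 0, 106765613563548, 9145904250133487355734, 0, true) := by
  decide +kernel

set_option maxHeartbeats 0 in
/-- The head accumulators `(T⁺, T⁻, I, S⁺, S⁻, ok)` on `d ∈ [28672, 32768)`. [folklore] -/
theorem head_28672 : headSums (parseRecs 20000 (digitsOf (fsegs1 ++ fsegs2))) 28672 4096 = (298180398300394657, 0, 98976111983680, 9146310812539040933846, 0, true) := by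
  decide +kernel

end Literature.NumberTheory.Sieve.RomanovCert
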